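import Mathlib.Tactic
import Mathlib.Analysis.Calculus.FDeriv.Comp

/-!
# N21 (NE7c) · the response rung's NUMERAL read at [B11] Theorem-1-type letters: it is Theorem 1's standing side
# condition `B₃ε₁ ≤ ε₀` WITH A MARGIN — `B₃ε₁·(1 + 16(1 + c_B)ε₁∕r) ≤ (1 − κ₀)(1 − ρ)·ε₀` (LOCATED bookkeeping; W-SEAT
# START-LIST v3 §n21 item 3, rung 3)

Width seat `pub-ymgap-dag-n21-w3` (g0), node N21 = NE7c (NOT PRINTED in [Bałaban 1983–89], NOT proved), lane K3⁷
`SpineGivenEndpointR13SepCoPH` (stmt-QuantumFields-20544, `--kind proof --supports … --as helper`).  Companion of this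
seat's files 1–2 (`…N21ResponseRadialTransversality` p583660, `…N21AnalyticResponseRemainder` p585983).

WHAT THE TWO RUNGS LEFT.  Part 34's radial-transversality binder `hRT` holds for the cube sup of an ANALYTIC response
once the NUMERAL `c₀ + 4MR² ≤ (1 − κ₀)θ(1 − ρ)` holds with `M = 2B∕r²` (file 2 `hRT_of_analyticResponse`): `r` =
analyticity radius of the block → plaquette-field response, `B` = its oscillation on the `r`-balls, `R` = radius of the
kept cut about the centre, `c₀` = core reading at the centre, `θ` = the tested threshold, `ρ` = relative shell width,
`κ₀` = the rate.  THIS FILE reads the numeral at letters of the TYPE [B11] = CMP 102 (1985) 277, Theorem 1 p. 279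
supplies (tree `B11.Thm1Printed`; the δ-linear transfer at NODE 00's background of record is dag-n21-c's
`N21RegularityTransferAtRecord.plaqSmall_UbgOfRecord_top_of_thm1_objects`, p456101: «`|U_k(s)(𝐖)(∂p) − 1| < B₃·δ·η_k²`
for `δ`-regular data»):
* (L1) CORE READING: `c₀ ≤ B₃·δ·σ` — the data in the cut are `δ`-regular ((7): `|∂V − 1| < δ`, `δ ↔ ε₁`), so by (8)
  every plaquette of the minimiser, in particular at the centre configuration, deviates `< B₃δσ` (`σ ↔ η²(L^jη)⁻²`,
  the scale factor of (2));
* (L2) SUP BOUND ON THE ANALYTICITY BALL ⇒ OSCILLATION: on the complex `r`-ball about a real cut point in the block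
  chart the perturbed data are `(δ + c_B r)`-regular (`c_B` = the located conversion constant of the chart, §0's `ℓ`),
  so — as long as `δ + c_B r ≤ a₁` (Theorem 1's THRESHOLD `ε₁ ≤ a₁` on the field strength of the data, p. 279: `a₁` is a
  threshold, not a radius; the admissible `r` is what the threshold leaves, `r ≤ (a₁ − δ)∕c_B`) and the minimiser
  depends ANALYTICALLY on complex regular data ([RG1] = [B12] = CMP 109 (1987) 249, Lemma 4 p. 280 ∕ (1.15)–(1.16)
  p. 262, «analytic on the above spaces» — THE analyticity source; Theorem 1 itself is stated for regular `Gᶜ`-valued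
  `V`) — the readings stay `≤ S := B₃(δ + c_B r)σ` and file 2's oscillation letter is `B ≤ 2S`
  (`oscillation_mapsTo_of_supBound`);
* (L3) KEPT-CUT RADIUS: `R ≤ δ` (the block's letters are among the data's) and `δ ≤ r` (the analyticity ball covers the
  kept cut; with (L2): `(1 + c_B)δ ≤ a₁`);
* (L4) THRESHOLD: `θ = ε₀·σ` (the tested (2.17)-type condition `|U(∂p) − 1| < ε₀σ`, `ε₀ ↔` the level's threshold).
§0 types the CHART FEED behind (L2) abstractly (`chart_mapsTo_closedBall`, `responseLetters_of_chart`): the response is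
`Φ = Ψ ∘ χ`, `χ` = the chart of one block's (complexified) integration variables into the configuration space
(differentiable, `ℓ`-Lipschitz about the real cut point on the `r`-ball — `ℓ ↔ c_B`), `Ψ` = the plaquette reading of the
minimiser, complex differentiable on an OPEN set `D ⊇ closedBall (χ(ι x)) (ℓr)` with `‖Ψ‖ ≤ S` on `D` (the Theorem 1 ∕
Lemma 4 shape: `D` = a complex regular space, `S = B₃·(its regularity radius)·σ`) ⇒ file 2's letters `hd` and `hB` with
`B = 2S` on `ball (ι x) r`.
Under (L1)–(L4) the numeral FOLLOWS from the MARGIN INEQUALITY `B₃δ(1 + 16(1 + c_B)δ∕r) ≤ (1 − κ₀)(1 − ρ)ε₀`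
(`numeral_of_thm1Letters`), i.e. Theorem 1's printed side condition «`B₃ε₁ ≤ ε₀`» (uniqueness clause, p. 279) with the
factor `(1 − κ₀)(1 − ρ)∕(1 + 16(1 + c_B)ε₁∕r) < 1` of room (`r ≤ (a₁ − ε₁)∕c_B`); conversely a margin `B₃δ ≤ λε₀` with
`λ(1 + 16(1 + c_B)δ∕r) ≤ (1 − κ₀)(1 − ρ)` suffices (`margin_of_ratio`), and for a prescribed room one may take the RATE
`κ₀ = 1 − λ(1 + 16(1 + c_B)δ∕r)∕(1 − ρ)` (`rate_of_margin`, positive iff `λ(1 + 16(1 + c_B)δ∕r) < 1 − ρ`).  WHERE THE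
ROOM IS IN
PRINT (located, NOT asserted): the factor-2 ladder of thresholds [LF-I] = CMP 122 (1989) 175, (1.22)–(1.23) p. 181
(«we change the regularity conditions by a factor») — the slack already booked in this node as threshold freedom
(`…N21DilationAgeWindow`, `T4LipschitzCutoff` §5∕§7; lens near-miss v3.0∕N212) — so the response road COSTS a fixed
fraction of that slack per level, uniformly in `K` iff `(1 + c_B)ε₁∕r` and `ρ_j` stay bounded away from the room.

HONEST FRAMING.  [bookkeeping] real arithmetic over DISPLAYED letter hypotheses (L1)–(L4); the identifications `↔` are a
located DICTIONARY, NOT asserted and NOT typed at NODE 00's objects; nothing of Bałaban's asserted; NE7c NOT PRINTED ∕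
NOT proved; N21 NOT discharged; counts unmoved (typed 28∕28 · discharged 5∕27); count-neutral; one finite 𝕋⁴ at fixed
ε — YM mass gap (Clay) is NOT proved by any of this: R4 closes the conditional finite-𝕋⁴ rung `BalabanLadder.UV` only;
nothing continuum ∕ ℝ⁴ ∕ OS ∕ mass gap ∕ Clay.
-/

namespace Summit.QuantumFields.YangMills.Theorems.N21ResponseRungNumeralAtThm1Letters

open Set Metric


/-- **A SUP BOUND GIVES FILE 2's OSCILLATION LETTER** (L2): if `‖Φ v‖ ≤ S` on `ball w r` and at `w`, then
`Φ(ball w r) ⊆ closedBall (Φ w) (2S)` — the hypothesis `hB` of `N21AnalyticResponseRemainder` with `B = 2S`.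
[bookkeeping] -/
theorem oscillation_mapsTo_of_supBound {W E : Type*} [PseudoMetricSpace W] [SeminormedAddCommGroup E] (Φ : W → E)
    {w : W} {r S : ℝ} (hS : ∀ v ∈ ball w r, ‖Φ v‖ ≤ S) (hw : ‖Φ w‖ ≤ S) :
    MapsTo Φ (ball w r) (closedBall (Φ w) (2 * S)) := by
  intro v hv
  rw [mem_closedBall, dist_eq_norm]
  calc ‖Φ v - Φ w‖ ≤ ‖Φ v‖ + ‖Φ w‖ := norm_sub_le _ _
    _ ≤ S + S := add_le_add (hS v hv) hw
    _ = 2 * S := by ring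

/-! ## §0  The chart feed behind (L2): `Φ = Ψ ∘ χ` ⇒ file 2's analytic letters -/

section Chart

variable {V W E : Type*} [NormedAddCommGroup V] [NormedSpace ℂ V] [NormedAddCommGroup W] [NormedSpace ℂ W]
  [NormedAddCommGroup E] [NormedSpace ℂ E]

omit [NormedSpace ℂ V] [NormedSpace ℂ W] in
/-- an `ℓ`-Lipschitz-about-the-centre chart maps the `r`-ball into the closed `ℓr`-ball about the image of the centre.
[bookkeeping] -/
theorem chart_mapsTo_closedBall (χ : V → W) {v₀ : V} {r ℓ : ℝ} (hℓ : 0 ≤ ℓ)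
    (hχℓ : ∀ v ∈ ball v₀ r, ‖χ v - χ v₀‖ ≤ ℓ * ‖v - v₀‖) :
    MapsTo χ (ball v₀ r) (closedBall (χ v₀) (ℓ * r)) := by
  intro v hv
  rw [mem_closedBall, dist_eq_norm]
  have hv' : ‖v - v₀‖ < r := by rwa [mem_ball, dist_eq_norm] at hv
  exact (hχℓ v hv).trans (mul_le_mul_of_nonneg_left hv'.le hℓ)

/-- **THE CHART FEED** (abstract form of (L2)): `χ` differentiable on `ball v₀ r` and `ℓ`-Lipschitz about `v₀` there,
`Ψ` complex differentiable on an open `D ⊇ closedBall (χ v₀) (ℓr)` with `‖Ψ‖ ≤ S` on `D` ⇒ the response `Φ = Ψ ∘ χ` is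
differentiable on `ball v₀ r` and maps it into `closedBall (Φ v₀) (2S)` — the hypotheses `hd`, `hB` (with `B = 2S`) of
`N21AnalyticResponseRemainder.quadraticRemainder_of_differentiableOn_ball` ∕ `hRT_of_analyticResponse`. [bookkeeping] -/
theorem responseLetters_of_chart (χ : V → W) (Ψ : W → E) {v₀ : V} {r ℓ S : ℝ} (hr : 0 < r) (hℓ : 0 ≤ ℓ)
    (hχd : DifferentiableOn ℂ χ (ball v₀ r)) (hχℓ : ∀ v ∈ ball v₀ r, ‖χ v - χ v₀‖ ≤ ℓ * ‖v - v₀‖)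
    {D : Set W} (hD : closedBall (χ v₀) (ℓ * r) ⊆ D) (hΨd : DifferentiableOn ℂ Ψ D) (hΨS : ∀ w ∈ D, ‖Ψ w‖ ≤ S) :
    DifferentiableOn ℂ (Ψ ∘ χ) (ball v₀ r) ∧ MapsTo (Ψ ∘ χ) (ball v₀ r) (closedBall ((Ψ ∘ χ) v₀) (2 * S)) := by
  have hχD : MapsTo χ (ball v₀ r) D := (chart_mapsTo_closedBall χ hℓ hχℓ).mono_right hD
  refine ⟨hΨd.comp hχd hχD, ?_⟩
  exact oscillation_mapsTo_of_supBound (Ψ ∘ χ) (fun v hv => hΨS _ (hχD hv)) (hΨS _ (hχD (mem_ball_self hr)))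

end Chart

/-- **THE NUMERAL AT THEOREM-1-TYPE LETTERS.**  Under (L1) `c₀ ≤ B₃δσ`, (L2) `B ≤ 2·B₃(δ + c_B r)σ`, (L3)
`0 ≤ R ≤ δ ≤ r`, `0 < r`, and the MARGIN `B₃δ(1 + 16(1 + c_B)δ∕r) ≤ (1 − κ₀)(1 − ρ)ε₀`, the response rung's numeral
with the Cauchy letter `M = 2B∕r²` holds at the threshold `θ = ε₀σ`:  `c₀ + 4(2B∕r²)R² ≤ (1 − κ₀)(ε₀σ(1 − ρ))`.
[bookkeeping] -/
theorem numeral_of_thm1Letters {c₀ B B₃ cB r δ R σ ε₀ κ₀ ρ : ℝ} (hσ : 0 ≤ σ) (hB₃ : 0 ≤ B₃) (hcB : 0 ≤ cB)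
    (hr : 0 < r) (hR0 : 0 ≤ R) (hRδ : R ≤ δ) (hδr : δ ≤ r)
    (hc₀ : c₀ ≤ B₃ * δ * σ) (hB : B ≤ 2 * (B₃ * (δ + cB * r) * σ))
    (hmargin : B₃ * δ * (1 + 16 * (1 + cB) * δ / r) ≤ (1 - κ₀) * (1 - ρ) * ε₀) :
    c₀ + 4 * (2 * B / r ^ 2) * R ^ 2 ≤ (1 - κ₀) * (ε₀ * σ * (1 - ρ)) := by
  have hδ0 : 0 ≤ δ := hR0.trans hRδ
  have hR2 : R ^ 2 ≤ δ ^ 2 := pow_le_pow_left₀ hR0 hRδ 2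
  -- the curvature term: 4·(2B/r²)·R² ≤ 16·B₃·(δ + c_B r)·σ·δ²/r²
  have h1 : 4 * (2 * B / r ^ 2) * R ^ 2 ≤ 16 * B₃ * (δ + cB * r) * σ * δ ^ 2 / r ^ 2 := by
    have hBr : 2 * B / r ^ 2 ≤ 2 * (2 * (B₃ * (δ + cB * r) * σ)) / r ^ 2 :=
      div_le_div_of_nonneg_right (by linarith) (by positivity)
    calc 4 * (2 * B / r ^ 2) * R ^ 2 ≤ 4 * (2 * (2 * (B₃ * (δ + cB * r) * σ)) / r ^ 2) * δ ^ 2 :=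
          mul_le_mul (mul_le_mul_of_nonneg_left hBr (by norm_num)) hR2 (sq_nonneg R) (by positivity)
      _ = 16 * B₃ * (δ + cB * r) * σ * δ ^ 2 / r ^ 2 := by field_simp; ring
  -- (δ + c_B r)·δ²/r² ≤ (1 + c_B)·δ²/r  (uses δ ≤ r)
  have h2 : 16 * B₃ * (δ + cB * r) * σ * δ ^ 2 / r ^ 2 ≤ 16 * B₃ * σ * ((1 + cB) * δ ^ 2 / r) := by
    have hnum : (δ + cB * r) * δ ^ 2 / r ^ 2 ≤ (1 + cB) * δ ^ 2 / r := by
      rw [div_le_div_iff₀ (by positivity) hr]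
      have : (δ + cB * r) ≤ (1 + cB) * r := by nlinarith
      calc (δ + cB * r) * δ ^ 2 * r ≤ ((1 + cB) * r) * δ ^ 2 * r :=
            mul_le_mul_of_nonneg_right (mul_le_mul_of_nonneg_right this (sq_nonneg δ)) hr.le
        _ = (1 + cB) * δ ^ 2 * r ^ 2 := by ring
    have h16 : 0 ≤ 16 * B₃ * σ := by positivity
    calc 16 * B₃ * (δ + cB * r) * σ * δ ^ 2 / r ^ 2 = 16 * B₃ * σ * ((δ + cB * r) * δ ^ 2 / r ^ 2) := by ring
      _ ≤ 16 * B₃ * σ * ((1 + cB) * δ ^ 2 / r) := mul_le_mul_of_nonneg_left hnum h16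
  -- the margin inequality, scaled by σ ≥ 0
  have h3 : (B₃ * δ * (1 + 16 * (1 + cB) * δ / r)) * σ ≤ ((1 - κ₀) * (1 - ρ) * ε₀) * σ :=
    mul_le_mul_of_nonneg_right hmargin hσ
  have h4 : (B₃ * δ * (1 + 16 * (1 + cB) * δ / r)) * σ
      = B₃ * δ * σ + 16 * B₃ * σ * ((1 + cB) * δ ^ 2 / r) := by
    field_simp
  calc c₀ + 4 * (2 * B / r ^ 2) * R ^ 2 ≤ B₃ * δ * σ + 16 * B₃ * σ * ((1 + cB) * δ ^ 2 / r) := by linarith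
    _ = (B₃ * δ * (1 + 16 * (1 + cB) * δ / r)) * σ := h4.symm
    _ ≤ ((1 - κ₀) * (1 - ρ) * ε₀) * σ := h3
    _ = (1 - κ₀) * (ε₀ * σ * (1 - ρ)) := by ring

/-- **A RATIO MARGIN SUFFICES.**  If `B₃δ ≤ λ·ε₀` (Theorem 1's side condition with room `λ`) and
`λ(1 + 16(1 + c_B)δ∕r) ≤ (1 − κ₀)(1 − ρ)`, then the margin inequality of `numeral_of_thm1Letters` holds. [bookkeeping] -/
theorem margin_of_ratio {B₃ cB r δ ε₀ κ₀ ρ lam : ℝ} (hε₀ : 0 ≤ ε₀) (hcB : 0 ≤ cB) (hr : 0 < r) (hδ : 0 ≤ δ)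
    (hratio : B₃ * δ ≤ lam * ε₀) (hroom : lam * (1 + 16 * (1 + cB) * δ / r) ≤ (1 - κ₀) * (1 - ρ)) :
    B₃ * δ * (1 + 16 * (1 + cB) * δ / r) ≤ (1 - κ₀) * (1 - ρ) * ε₀ := by
  have hf : 0 ≤ 1 + 16 * (1 + cB) * δ / r := by positivity
  calc B₃ * δ * (1 + 16 * (1 + cB) * δ / r) ≤ lam * ε₀ * (1 + 16 * (1 + cB) * δ / r) :=
        mul_le_mul_of_nonneg_right hratio hf
    _ = (lam * (1 + 16 * (1 + cB) * δ / r)) * ε₀ := by ring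
    _ ≤ ((1 - κ₀) * (1 - ρ)) * ε₀ := mul_le_mul_of_nonneg_right hroom hε₀
    _ = (1 - κ₀) * (1 - ρ) * ε₀ := by ring

/-- **THE RATE BOUGHT BY A GIVEN ROOM.**  For `f := λ(1 + 16(1 + c_B)δ∕r) < 1 − ρ` (`ρ < 1`) the rate
`κ₀ := 1 − f∕(1 − ρ)` is positive and meets `f ≤ (1 − κ₀)(1 − ρ)` with equality — the largest rate the margin allows;
part 34's (M1) constant `3(#κ+1)(1+Q)∕(κ₀(1−ρ))` is then explicit in the room. [bookkeeping] -/
theorem rate_of_margin {cB r δ ρ lam : ℝ} (hρ : ρ < 1) (hroom : lam * (1 + 16 * (1 + cB) * δ / r) < 1 - ρ) :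
    0 < 1 - lam * (1 + 16 * (1 + cB) * δ / r) / (1 - ρ) ∧
      lam * (1 + 16 * (1 + cB) * δ / r)
        ≤ (1 - (1 - lam * (1 + 16 * (1 + cB) * δ / r) / (1 - ρ))) * (1 - ρ) := by
  have h1ρ : 0 < 1 - ρ := by linarith
  refine ⟨?_, ?_⟩
  · rw [sub_pos, div_lt_one h1ρ]
    exact hroom
  · rw [sub_sub_cancel, div_mul_cancel₀ _ h1ρ.ne']

/-- **WORKED LETTERS** (A2: the hypotheses of `numeral_of_thm1Letters` are jointly satisfiable with a strict margin and
a positive rate): `B₃ = 4`, `c_B = 1`, `r = 1`, `δ = R = 1∕100` (`↔ ε₁`), `σ = 1`, `ε₀ = 1∕4`, `ρ = 1∕10`,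
`κ₀ = 1∕2`, `c₀ = B₃δσ = 1∕25`, `B = 2B₃(δ + c_B r)σ = 8.08`: room `λ = B₃δ∕ε₀ = 0.16`, `λ(1 + 32δ) = 0.2112 ≤
(1 − κ₀)(1 − ρ) = 0.45`. [bookkeeping] -/
theorem numeral_of_thm1Letters_instance :
    (1 / 25 : ℝ) + 4 * (2 * (808 / 100) / 1 ^ 2) * (1 / 100) ^ 2 ≤ (1 - 1 / 2) * (1 / 4 * 1 * (1 - 1 / 10)) :=
  numeral_of_thm1Letters (c₀ := 1 / 25) (B := 808 / 100) (B₃ := 4) (cB := 1) (r := 1) (δ := 1 / 100) (R := 1 / 100)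
    (σ := 1) (ε₀ := 1 / 4) (κ₀ := 1 / 2) (ρ := 1 / 10) (by norm_num) (by norm_num) (by norm_num) (by norm_num)
    (by norm_num) le_rfl (by norm_num) (by norm_num) (by norm_num) (by norm_num)

end Summit.QuantumFields.YangMills.Theorems.N21ResponseRungNumeralAtThm1Letters
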